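/-
Copyright (c) 2026. All rights reserved.
Released under Apache 2.0 license as described in the file LICENSE.
Authors: abc-iut cell, seat abc-iut-L6-t6 (bridge for abc-iut-L6-t4's `GlobalFrobenioidModels.lean`).
-/
import Mathlib.Tactic.Module
import Literature.IUT.LogThetaLattice.GlobalFrobenioidModelsCategory
import HarnessLib

/-!
# [IUTchIII] Example 3.6 (ii): the model-Frobenioid data of `𝓕⊛_𝔪𝔬𝔡` and the comparison functor

S. Mochizuki, *Inter-universal Teichmüller Theory III*, kurims manuscript (May 2020), Example 3.6 (ii),
p. 108 l. 5–11 [claim key Mochizuki2012, status disputed (D-0012)]: "`𝓕⊛_𝔪𝔬𝔡` admits a natural Frobenioid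
structure [cf. [FrdI], Definition 1.3], for which the base category is the category with precisely one
arrow." The natural way to VERIFY this sentence in the tree's vocabulary is [FrdI] Theorem 5.2: `𝓕⊛_𝔪𝔬𝔡`
is (equivalent, over `F_Φ`, to) the MODEL FROBENIOID of the data

* `𝒟 :=` the one-morphism category (`Base`);
* `Φ(∗) :=` the monoid of effective families `{D_v ∈ Γ_v^{≥0}}` (`effDiv`, previous file), a divisorial
  monoid (`isDivisorial_effDiv`: integral, saturated, sharp — from the corresponding properties of the
  cones `Γ_v^{≥0}`), constant on `𝒟` (`Φmod`, a monoid on `𝒟`: `isMonoidOn_constMonoidOn`);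
* `𝔹(∗) := F^×_mod` (`Bmod`, group-like) with `Div_𝔹(f) := (β_v(f))_v ∈ Φ(∗)^gp` (`betaDiv`, `divBmod`),

and this file constructs that data together with the comparison functor
`toModel : 𝓕⊛_𝔪𝔬𝔡 ⥤ ModelFrobenioid Φmod Bmod divBmod`, `𝔍 ↦ (∗, -[𝔍])`, `(n, f) ↦ (n, id, f·𝔍₁^n·𝔍₂^{-1}, f)`
(the class of the object `𝔍 = {λ_v 𝒪_v}` in `Φ^gp = ⊕_v Γ_v` is `-([λ_v])_v`: with this sign the defining
relation `n·α₁ + Div(φ) = α₂ + Div_𝔹(f)` of [FrdI] Thm. 5.2 (i) is exactly the integrality condition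
`β_v(f) + n[λ_{1,v}] - [λ_{2,v}] ≥ 0` of Ex. 3.6 (ii)), proves that `toModel` is an EQUIVALENCE of categories
(full: relation (d) is `u`'s integrality; faithful; essentially surjective: every class is `-[𝔍]`), and
defines the structure functor `𝓕⊛_𝔪𝔬𝔡 → F_Φ` (`structureFunctor := toModel ⋙ ModelFrobenioid.toElem`; compare
the author's own form of such comparisons, *Comments on Frobenioids* (Dec. 2015) R23 "Proposition T":
`(A_D, α) ↦` the trivialisation shifted by `−α`). That the structure is a FROBENIOID is in
`GlobalFrobenioidModelsFrobenioid.lean`. Nothing here takes a side on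
[IUTchIII] Cor. 3.12; typed ≠ endorsed.
-/

noncomputable section

namespace Literature.IUT.LogThetaLattice

namespace GlobalFrobenioidModels

open CategoryTheory Opposite Literature.AlgebraicGeometry.Frobenioids

universe u

variable {F : Type u} [Field F] {V : Type u} {Γ : V → Type u} [∀ v, AddCommGroup (Γ v)]
  {nonneg : ∀ v, AddSubmonoid (Γ v)} {β : ∀ v, Additive Fˣ →+ Γ v}

/-! ### The base category `𝒟`: "the category with precisely one arrow" -/

/-- The base category of the Frobenioid structure of `𝓕⊛_𝔪𝔬𝔡`: "the category with precisely one arrow"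
(p. 108 l. 8). ([IUTchIII] Ex 3.6 (ii) p.108) [claim: Mochizuki2012, status: disputed] -/
abbrev Base : Type u := Discrete PUnit.{u + 1}

/-- Its unique object. ([IUTchIII] Ex 3.6 (ii) p.108) [claim: Mochizuki2012, status: disputed] -/
abbrev pt : Base.{u} := ⟨PUnit.unit⟩

/-- Every arrow of the one-morphism category is an isomorphism. ([IUTchIII] Ex 3.6 (ii) p.108) [claim: Mochizuki2012, status: disputed] -/
theorem isIso_base {X Y : Base.{u}} (f : X ⟶ Y) : IsIso f :=
  ⟨⟨eqToHom (by cases X; cases Y; rfl), Subsingleton.elim _ _, Subsingleton.elim _ _⟩⟩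

/-- The one-morphism category is connected. ([IUTchIII] Ex 3.6 (ii) p.108) [claim: Mochizuki2012, status: disputed] -/
theorem isGraphConnected_base : IsGraphConnected Base.{u} :=
  ⟨⟨pt⟩, fun X Y => by
    cases X; cases Y
    exact Zigzag.refl _⟩

/-- The one-morphism category is totally epimorphic. ([IUTchIII] Ex 3.6 (ii) p.108) [claim: Mochizuki2012, status: disputed] -/
theorem isTotallyEpimorphic_base : IsTotallyEpimorphic Base.{u} :=
  ⟨fun f => by haveI := isIso_base f; infer_instance⟩

/-! ### The divisor monoid `Φ` and the rational function monoid `𝔹` -/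

variable (V Γ nonneg) in
/-- `Φ`: the effective families, as a (constant) monoid on the one-morphism base.
([IUTchIII] Ex 3.6 (ii) p.108) [claim: Mochizuki2012, status: disputed] -/
abbrev Φmod : Base.{u}ᵒᵖ ⥤ CommMonCat.{u} := constMonoidOn (EffDiv V Γ nonneg)

variable (F) in
/-- `𝔹`: the rational function monoid `F^×_mod`, as a (constant) monoid on the one-morphism base.
([IUTchIII] Ex 3.6 (ii) p.108) [claim: Mochizuki2012, status: disputed] -/
abbrev Bmod : Base.{u}ᵒᵖ ⥤ CommMonCat.{u} := constMonoidOn Fˣ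

section Hyps

variable (H : ModelHyps nonneg β)
include H

/-- `f ↦ (β_v(f))_v`: the (principal) divisor of `f ∈ F^×_mod` as a family of classes — finitely supported
because `f` is a unit at almost all `v`. ([IUTchIII] Ex 3.6 (i) p.107) [claim: Mochizuki2012, status: disputed] -/
def betaDiv : Fˣ →* Multiplicative (FrakObj V Γ) where
  toFun f := Multiplicative.ofAdd ⟨fun v => β v (Additive.ofMul f), H.finite f⟩
  map_one' := by
    rw [← ofAdd_zero]
    congr 1
    exact FrakObj.ext_cls (funext fun v => by
      show β v (Additive.ofMul 1) = 0
      rw [ofMul_one, map_zero])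
  map_mul' f g := by
    rw [← ofAdd_add]
    congr 1
    exact FrakObj.ext_cls (funext fun v => by
      show β v (Additive.ofMul (f * g)) = β v (Additive.ofMul f) + β v (Additive.ofMul g)
      rw [ofMul_mul, map_add])

/-- The classes of `betaDiv f`. ([IUTchIII] Ex 3.6 (i) p.107) [claim: Mochizuki2012, status: disputed] -/
@[simp] theorem cls_betaDiv (f : Fˣ) (v : V) :
    (Multiplicative.toAdd (betaDiv H f)).cls v = β v (Additive.ofMul f) := rfl

/-- `Div_𝔹 : F^×_mod → Φ(∗)^gp`, `f ↦ (β_v(f))_v`. ([IUTchIII] Ex 3.6 (ii) p.108) [claim: Mochizuki2012, status: disputed] -/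
def divBHom : Fˣ →* Algebra.GrothendieckGroup (EffDiv V Γ nonneg) := (toGp H).comp (betaDiv H)

/-- `Div_𝔹` as a homomorphism of monoids on the one-morphism base. ([IUTchIII] Ex 3.6 (ii) p.108) [claim: Mochizuki2012, status: disputed] -/
def divBmod : Bmod F ⟶ monoidGp (Φmod V Γ nonneg) where
  app _ := CommMonCat.ofHom (divBHom H)
  naturality X Y f := by
    apply CommMonCat.hom_ext
    refine MonoidHom.ext fun u => ?_
    change divBHom H u = MonGp.map (MonoidHom.id _) (divBHom H u)
    rw [MonGp.map_id]
    rfl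

/-- `Div_𝔹` at the unique object is `divBHom`. ([IUTchIII] Ex 3.6 (ii) p.108) [claim: Mochizuki2012, status: disputed] -/
theorem divB_divBmod (u : Fˣ) :
    divB (Φmod V Γ nonneg) (Bmod F) (divBmod H) (op pt) u = divBHom H u := rfl

/-! ### Every class is the class of a family -/

/-- Every element of `Φ(∗)^gp` is the class of a family (`toGp` is surjective).
([IUTchIII] Ex 3.6 (ii) p.108) [claim: Mochizuki2012, status: disputed] -/
theorem toGp_surjective : Function.Surjective (toGp H) := by
  intro x
  obtain ⟨⟨a, b⟩, h⟩ := (Localization.monoidOf (⊤ : Submonoid (EffDiv V Γ nonneg))).surj x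
  have hx : x = Algebra.GrothendieckGroup.of a / Algebra.GrothendieckGroup.of (b : EffDiv V Γ nonneg) :=
    eq_div_iff_mul_eq'.mpr h
  refine ⟨Multiplicative.ofAdd ((Multiplicative.toAdd a : effDiv V Γ nonneg) -
    (Multiplicative.toAdd (b : EffDiv V Γ nonneg) : effDiv V Γ nonneg)), ?_⟩
  rw [hx, toGp_ofAdd, toGpFun_eq_div H _ (Multiplicative.toAdd a).2 (Multiplicative.toAdd (b : EffDiv V Γ nonneg)).2 rfl]
  rfl

/-! ### The model Frobenioid of the data and the comparison functor `𝓕⊛_𝔪𝔬𝔡 ⥤ ModelFrobenioid` -/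

/-- The model Frobenioid ([FrdI] Thm. 5.2 (i)) of the data `(𝒟, Φ, 𝔹, Div_𝔹)` read off from `𝓕⊛_𝔪𝔬𝔡`.
([IUTchIII] Ex 3.6 (ii) p.108) [claim: Mochizuki2012, status: disputed] -/
abbrev FrakModel : Type u := ModelFrobenioid (Φmod V Γ nonneg) (Bmod F) (divBmod H)

/-- The divisor of a morphism `(n, f) : 𝔍₁ → 𝔍₂` as an effective family:
`(β_v(f) + n[λ_{1,v}] - [λ_{2,v}])_v ≥ 0` — "the fractional ideal `f · 𝔍₁^{⊗n} · 𝔍₂^{⊗(-1)} ⊆ 𝒪`".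
([IUTchIII] Ex 3.6 (ii) p.108) [claim: Mochizuki2012, status: disputed] -/
def homDiv {X Y : FrakCat F V Γ nonneg β} (φ : X ⟶ Y) : EffDiv V Γ nonneg :=
  Multiplicative.ofAdd ⟨Multiplicative.toAdd (betaDiv H (FrakCat.fn φ)) +
      ((FrakCat.deg φ : ℕ) : ℤ) • X.obj - Y.obj, fun v => by
    simpa only [FrakObj.cls_sub, FrakObj.cls_add, FrakObj.cls_zsmul, cls_betaDiv] using
      FrakCat.mem_nonneg φ v⟩

/-- The family underlying `homDiv φ`. ([IUTchIII] Ex 3.6 (ii) p.108) [claim: Mochizuki2012, status: disputed] -/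
theorem coe_homDiv {X Y : FrakCat F V Γ nonneg β} (φ : X ⟶ Y) :
    ((Multiplicative.toAdd (homDiv H φ) : effDiv V Γ nonneg) : FrakObj V Γ) =
      Multiplicative.toAdd (betaDiv H (FrakCat.fn φ)) + ((FrakCat.deg φ : ℕ) : ℤ) • X.obj - Y.obj := rfl

/-- The class `-[𝔍] ∈ Φ(∗)^gp` of an object of `𝓕⊛_𝔪𝔬𝔡`. ([IUTchIII] Ex 3.6 (ii) p.108) [claim: Mochizuki2012, status: disputed] -/
def objCls (X : FrakCat F V Γ nonneg β) : Algebra.GrothendieckGroup (EffDiv V Γ nonneg) :=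
  toGp H (Multiplicative.ofAdd (-X.obj))

/-- **The comparison functor `𝓕⊛_𝔪𝔬𝔡 ⥤ ModelFrobenioid(𝒟, Φ, 𝔹, Div_𝔹)`**: `𝔍 ↦ (∗, -[𝔍])`,
`(n, f) ↦ (n, id, f·𝔍₁^{⊗n}·𝔍₂^{⊗(-1)}, f)`; relation (d) of [FrdI] Thm. 5.2 (i) is the integrality condition of
Ex. 3.6 (ii). ([IUTchIII] Ex 3.6 (ii) p.108) [claim: Mochizuki2012, status: disputed] -/
def toModel : FrakCat F V Γ nonneg β ⥤ FrakModel H where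
  obj X := ⟨pt, objCls H X⟩
  map {X Y} φ :=
    { degFr := FrakCat.deg φ
      base := 𝟙 _
      div := homDiv H φ
      unit := FrakCat.fn φ
      rel := by
        rw [pullGp_id, divB_divBmod]
        have hd : Algebra.GrothendieckGroup.of (homDiv H φ) =
            toGp H (Multiplicative.ofAdd
              ((Multiplicative.toAdd (homDiv H φ) : effDiv V Γ nonneg) : FrakObj V Γ)) := by
          rw [toGp_ofAdd, toGpFun_of_mem H (Multiplicative.toAdd (homDiv H φ)).2]
          rfl
        show objCls H X ^ (FrakCat.deg φ : ℕ) * Algebra.GrothendieckGroup.of (homDiv H φ) =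
          objCls H Y * divBHom H (FrakCat.fn φ)
        rw [hd]
        unfold objCls divBHom
        rw [MonoidHom.comp_apply, ← map_pow, ← map_mul, ← map_mul]
        congr 1
        apply Multiplicative.toAdd.injective
        simp only [toAdd_mul, toAdd_pow, toAdd_ofAdd, coe_homDiv, smul_neg, natCast_zsmul]
        abel }
  map_id X := by
    refine ModelFrobenioid.Hom.ext rfl rfl ?_ rfl
    show homDiv H (𝟙 X) = 1
    apply Multiplicative.toAdd.injective
    apply Subtype.ext
    rw [coe_homDiv]
    show Multiplicative.toAdd (betaDiv H 1) + (((1 : ℕ+) : ℕ) : ℤ) • X.obj - X.obj = (0 : FrakObj V Γ)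
    rw [map_one, toAdd_one, PNat.one_coe, Nat.cast_one, one_zsmul, zero_add, sub_self]
  map_comp {X Y Z} φ ψ := by
    refine ModelFrobenioid.Hom.ext rfl (Subsingleton.elim _ _) ?_ rfl
    show homDiv H (φ ≫ ψ) = homDiv H ψ * homDiv H φ ^ (FrakCat.deg ψ : ℕ)
    apply Multiplicative.toAdd.injective
    apply Subtype.ext
    simp only [toAdd_mul, toAdd_pow, AddSubmonoid.coe_add, AddSubmonoidClass.coe_nsmul, coe_homDiv,
      FrakCat.fn_comp, FrakCat.deg_comp, map_mul, map_pow, PNat.mul_coe, Nat.cast_mul, ← natCast_zsmul]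
    module

/-- `toModel` on objects: base `∗`, class `-[𝔍]`. ([IUTchIII] Ex 3.6 (ii) p.108) [claim: Mochizuki2012, status: disputed] -/
@[simp] theorem toModel_obj_base (X : FrakCat F V Γ nonneg β) : ((toModel H).obj X).base = pt := rfl

/-- `toModel` on objects: the class. ([IUTchIII] Ex 3.6 (ii) p.108) [claim: Mochizuki2012, status: disputed] -/
theorem toModel_obj_cls (X : FrakCat F V Γ nonneg β) : ((toModel H).obj X).cls = objCls H X := rfl

/-- `toModel` preserves the Frobenius degree. ([IUTchIII] Ex 3.6 (ii) p.108) [claim: Mochizuki2012, status: disputed] -/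
@[simp] theorem degFr_toModel_map {X Y : FrakCat F V Γ nonneg β} (φ : X ⟶ Y) :
    ModelFrobenioid.degFr ((toModel H).map φ) = FrakCat.deg φ := rfl

/-- `toModel` sends `(n, f)` to the unit `f`. ([IUTchIII] Ex 3.6 (ii) p.108) [claim: Mochizuki2012, status: disputed] -/
@[simp] theorem unit_toModel_map {X Y : FrakCat F V Γ nonneg β} (φ : X ⟶ Y) :
    ModelFrobenioid.unit ((toModel H).map φ) = FrakCat.fn φ := rfl

/-- `toModel` sends `(n, f)` to the divisor `f · 𝔍₁^{⊗n} · 𝔍₂^{⊗(-1)}`. ([IUTchIII] Ex 3.6 (ii) p.108) [claim: Mochizuki2012, status: disputed] -/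
theorem div_toModel_map {X Y : FrakCat F V Γ nonneg β} (φ : X ⟶ Y) :
    ModelFrobenioid.div ((toModel H).map φ) = homDiv H φ := rfl

/-! ### `toModel` is an equivalence of categories -/

/-- The relation (d) of a morphism of the model Frobenioid between objects in the image of `toModel`
says exactly that its unit `u ∈ F^×_mod` is integral: `Div = u · 𝔍₁^{⊗n} · 𝔍₂^{⊗(-1)}` as families.
([IUTchIII] Ex 3.6 (ii) p.108) [claim: Mochizuki2012, status: disputed] -/
theorem coe_div_eq_of_hom {X Y : FrakCat F V Γ nonneg β} (ψ : (toModel H).obj X ⟶ (toModel H).obj Y) :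
    (Multiplicative.toAdd (ModelFrobenioid.div ψ : EffDiv V Γ nonneg)).1 =
      Multiplicative.toAdd (betaDiv H (ModelFrobenioid.unit ψ : Fˣ)) +
        ((ModelFrobenioid.degFr ψ : ℕ) : ℤ) • X.obj - Y.obj := by
  change (⟨pt, objCls H X⟩ : FrakModel H) ⟶ ⟨pt, objCls H Y⟩ at ψ
  have hb : ModelFrobenioid.baseMap ψ = 𝟙 pt := Subsingleton.elim _ _
  have hrel := ModelFrobenioid.rel ψ
  rw [hb, pullGp_id, divB_divBmod] at hrel
  change objCls H X ^ (ModelFrobenioid.degFr ψ : ℕ) *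
      Algebra.GrothendieckGroup.of (M := EffDiv V Γ nonneg) (ModelFrobenioid.div ψ) =
    objCls H Y * divBHom H (ModelFrobenioid.unit ψ : Fˣ) at hrel
  have hd : Algebra.GrothendieckGroup.of (M := EffDiv V Γ nonneg) (ModelFrobenioid.div ψ) =
      toGp H (Multiplicative.ofAdd (Multiplicative.toAdd (ModelFrobenioid.div ψ : EffDiv V Γ nonneg)).1) := by
    rw [toGp_ofAdd, toGpFun_of_mem H (Multiplicative.toAdd (ModelFrobenioid.div ψ : EffDiv V Γ nonneg)).2]
    rfl
  rw [hd] at hrel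
  unfold objCls divBHom at hrel
  rw [MonoidHom.comp_apply, ← map_pow, ← map_mul, ← map_mul] at hrel
  have h := congrArg Multiplicative.toAdd (toGp_injective H hrel)
  simp only [toAdd_mul, toAdd_pow, toAdd_ofAdd, smul_neg, natCast_zsmul] at h ⊢
  -- h : -(n • X.obj) + Div = -Y.obj + b(u)
  calc (Multiplicative.toAdd (ModelFrobenioid.div ψ : EffDiv V Γ nonneg)).1
      = (ModelFrobenioid.degFr ψ : ℕ) • X.obj + (-((ModelFrobenioid.degFr ψ : ℕ) • X.obj) +
          (Multiplicative.toAdd (ModelFrobenioid.div ψ : EffDiv V Γ nonneg)).1) := by abel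
    _ = (ModelFrobenioid.degFr ψ : ℕ) • X.obj +
          (-Y.obj + Multiplicative.toAdd (betaDiv H (ModelFrobenioid.unit ψ : Fˣ))) := by rw [h]
    _ = _ := by abel

/-- `toModel` is FULL: a morphism `(n, 𝟙, Div, u)` of the model Frobenioid between `(∗, -[𝔍₁])` and
`(∗, -[𝔍₂])` is the image of the morphism `(n, u)` of `𝓕⊛_𝔪𝔬𝔡` (relation (d) is `u`'s integrality).
([IUTchIII] Ex 3.6 (ii) p.108) [claim: Mochizuki2012, status: disputed] -/
theorem toModel_full : (toModel H).Full where
  map_surjective {X Y} ψ := by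
    have hcoe := coe_div_eq_of_hom H ψ
    have hhom : FrakObj.IsHom (nonneg := nonneg) (β := β) X.obj Y.obj (ModelFrobenioid.degFr ψ)
        (ModelFrobenioid.unit ψ : Fˣ) := by
      intro v
      have hv : ((Multiplicative.toAdd (ModelFrobenioid.div ψ : EffDiv V Γ nonneg)).1).cls v ∈ nonneg v :=
        (Multiplicative.toAdd (ModelFrobenioid.div ψ : EffDiv V Γ nonneg)).2 v
      rw [hcoe] at hv
      simp only [FrakObj.cls_sub, FrakObj.cls_add, FrakObj.cls_zsmul, cls_betaDiv] at hv
      exact hv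
    refine ⟨FrakCat.homMk _ _ hhom, ModelFrobenioid.Hom.ext rfl (Subsingleton.elim _ _) ?_ rfl⟩
    show homDiv H (FrakCat.homMk _ _ hhom) = (ModelFrobenioid.div ψ : EffDiv V Γ nonneg)
    apply Multiplicative.toAdd.injective
    apply Subtype.ext
    exact hcoe.symm

/-- `toModel` is FAITHFUL: `(n, f)` is recovered as (Frobenius degree, unit). ([IUTchIII] Ex 3.6 (ii) p.108) [claim: Mochizuki2012, status: disputed] -/
theorem toModel_faithful : (toModel H).Faithful where
  map_injective {_ _} := fun _ _ h =>
    FrakCat.hom_ext (congrArg ModelFrobenioid.Hom.degFr h) (congrArg ModelFrobenioid.Hom.unit h)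

/-- `toModel` is ESSENTIALLY SURJECTIVE: every class in `Φ(∗)^gp = ⊕_v Γ_v` is `-[𝔍]` for a family `𝔍`
(`Γ_v` is generated by `Γ_v^{≥0}`). ([IUTchIII] Ex 3.6 (ii) p.108) [claim: Mochizuki2012, status: disputed] -/
theorem toModel_essSurj : (toModel H).EssSurj where
  mem_essImage M := by
    obtain ⟨b, c⟩ := M
    obtain ⟨⟨⟩⟩ := b
    obtain ⟨y, hy⟩ := toGp_surjective H c
    refine ⟨FrakCat.of (-(Multiplicative.toAdd y)), ⟨eqToIso ?_⟩⟩
    show (⟨pt, objCls H (FrakCat.of (-(Multiplicative.toAdd y)))⟩ : FrakModel H) = ⟨pt, c⟩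
    congr 1
    unfold objCls
    rw [FrakCat.obj_of, neg_neg]
    exact hy

/-- **`𝓕⊛_𝔪𝔬𝔡 ≌ ModelFrobenioid(𝒟, Φ, 𝔹, Div_𝔹)`**: the comparison functor is an equivalence of categories.
([IUTchIII] Ex 3.6 (ii) p.108) [claim: Mochizuki2012, status: disputed] -/
instance toModel_isEquivalence : (toModel H).IsEquivalence :=
  haveI := toModel_full H
  haveI := toModel_faithful H
  haveI := toModel_essSurj H
  { }

/-! ### The structure functor `𝓕⊛_𝔪𝔬𝔡 → F_Φ` -/

/-- **The natural Frobenioid structure of `𝓕⊛_𝔪𝔬𝔡`**: the functor `𝓕⊛_𝔪𝔬𝔡 → F_Φ`, `𝔍 ↦ ∗`,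
`(n, f) ↦ (id_∗, f · 𝔍₁^{⊗n} · 𝔍₂^{⊗(-1)}, n)` (p. 108 l. 5–8), obtained through the model Frobenioid.
([IUTchIII] Ex 3.6 (ii) p.108) [claim: Mochizuki2012, status: disputed] -/
def structureFunctor : FrakCat F V Γ nonneg β ⥤ ElemFrobenioid (Φmod V Γ nonneg) :=
  toModel H ⋙ ModelFrobenioid.toElem (Φmod V Γ nonneg) (Bmod F) (divBmod H)

end Hyps

end GlobalFrobenioidModels

end Literature.IUT.LogThetaLattice
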